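import Summits.Ventures.YMGap.RobustBall.StateStabilityS
import HarnessLib

/-!
# Venture YMGap, track ROBUST-BALL (Y2) — TIER 2: CONNECTED CORRELATIONS ARE LIPSCHITZ IN THE ACTION, UNIFORMLY ON THE WEIGHTED BALL

HONEST FRAMING. WHAT THIS IS: a venture file (cell `pub-ymgap`, track Y2 ROBUST-BALL, seat rb-p1, theorems only), a corollary of the tier-2
state stability of `StateStabilityS.lean` (inside the one-link pair door `ρ := 6(d−1)|β| e^{a} e^{t} √(cv) + e^{a/2} √c Λ_t < 1` on the
weighted infinite-range ball `MemBallZdS a Λ_t t`, the state moves by `≤ (√N/2)·min(η,4)/(1−ρ)·Σδ` on a local Frobenius-Lipschitz observable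
under a summable modification `V'` of the action with one-link oscillation load `η`):
* ★ `abs_cov_sub_cov_le_of_perturbation_S` — member `W`, modification `V' ∈ MemBallZdS η Λ_η t` (continuous link-summable terms of ANY
  strength and ANY range; only the oscillation load `η` enters), every DLR `μ` of `W`, EVERY DLR `μ'` of `W + V'`, every two local
  Frobenius-Lipschitz observables `f` (on `Δ_f`, vector `δ_f`) and `g` (on `Δ_g`, `δ_g`):
  `|cov_{μ'}(f, g) − cov_μ(f, g)| ≤ 4N · min(η, 4)/(1 − ρ) · (Σ_{Δ_f} δ_f)(Σ_{Δ_g} δ_g)` — CONNECTED CORRELATIONS OF EVERY MEMBER RESPOND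
  LIPSCHITZ-CONTINUOUSLY, IN THE OSCILLATION-LOAD SEMINORM, TO EVERY SUMMABLE MODIFICATION OF THE ACTION (centring both observables at the
  unit configuration, where `|f − f(1)| ≤ 2√N Σδ_f` by interpolation along the links of the support, then three applications of state
  stability: to `(f−f(1))(g−g(1))`, to `f−f(1)` and to `g−g(1)`);
* `su2_abs_cov_sub_cov_le_dim4` — `SU(2)`, `ℤ⁴`, hypothesis-free: `6|β_W| e^{a} e^{t} + e^{a/2} √(2/3) Λ < 1` ⇒ on `MemBallZdS a Λ t`, for
  Lipschitz cylinders, `|cov_{μ'}(F, G) − cov_μ(F, G)| ≤ 8 · min(η,4)/(1 − ρ) · (#Λ_F K_F)(#Λ_G K_G)`.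
This is the per-term input of `SusceptibilityHoelderS.lean` (the susceptibility series is Hölder-½ in the action).
WHAT THIS IS NOT: one-sided (only the member's side contracts; nothing about uniqueness for `W + V'`); Dobrushin-comparison constants at
lattice strong coupling; nothing about the continuum limit or a Clay-sense mass gap.
-/

noncomputable section

open MeasureTheory Function Finset ProbabilityTheory Real
open scoped NNReal
open Literature.Probability.LatticeModels
open Literature.Probability.LatticeModels.DobrushinMetric
open Literature.MathematicalPhysics.QuantumLattice
open Literature.MathematicalPhysics.QuantumFieldTheory hiding ZdEdge
open Summit.QuantumFields.BalabanUV.InfraRed.StrongCouplingPoincareDoorSUN (oneLinkPoincareSUN_two_sharp)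

namespace Summit.Ventures.YMGap.RobustBall

variable {d N : ℕ}

section SUN

variable {W V' : Potential (ZdEdge d) (Matrix.specialUnitaryGroup (Fin N) ℂ)}

/-- ★ **CONNECTED CORRELATIONS ARE LIPSCHITZ IN THE ACTION, uniformly on the weighted ball.**  Member `W ∈ MemBallZdS a Λ_t t` inside the
pair door `ρ := 6(d−1)|β| e^{a} e^{t} √(cv) + e^{a/2} √c Λ_t < 1` (`t ≥ 0`); modification `V' ∈ MemBallZdS η Λ_η t` (only its one-link
oscillation load `η` enters; any strength, any range); `μ` any DLR state of `W`, `μ'` ANY DLR state of `W + V'`; `f`, `g` measurable, local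
on `Δ_f`, `Δ_g`, with Frobenius-Lipschitz vectors `δ_f`, `δ_g`.  Then
`|cov_{μ'}(f, g) − cov_μ(f, g)| ≤ 4N · min(η, 4)/(1 − ρ) · (Σ_{Δ_f} δ_f) · (Σ_{Δ_g} δ_g)`. -/
theorem abs_cov_sub_cov_le_of_perturbation_S (hd : 1 ≤ d) (hN : 1 ≤ N) {β b c v a Λt t : ℝ}
    (hc : 0 ≤ c) (hv : 0 ≤ v) (hb : |β| * (2 * ((d : ℝ) - 1)) ≤ b)
    (hP : ∀ B : Matrix (Fin N) (Fin N) ℂ, matrixOpNorm B ≤ b →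
      ∀ (ψ : Matrix.specialUnitaryGroup (Fin N) ℂ → ℝ) (M : ℝ), 0 ≤ M →
        (∀ x y, |ψ x - ψ y| ≤ M * suFrobDist x y) →
        Var[ψ; (haarProbability (Matrix.specialUnitaryGroup (Fin N) ℂ)).tilted
          fun g => (N : ℝ) * ((g : Matrix (Fin N) (Fin N) ℂ) * B).trace.re] ≤ c * M ^ 2)
    (hVB : ∀ B : Matrix (Fin N) (Fin N) ℂ, matrixOpNorm B ≤ b → ∀ Δ : Matrix (Fin N) (Fin N) ℂ,
      Var[fun g : Matrix.specialUnitaryGroup (Fin N) ℂ =>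
          (N : ℝ) * ((g : Matrix (Fin N) (Fin N) ℂ) * Δ).trace.re;
        (haarProbability (Matrix.specialUnitaryGroup (Fin N) ℂ)).tilted
          fun g => (N : ℝ) * ((g : Matrix (Fin N) (Fin N) ℂ) * B).trace.re] ≤ v * frobNorm Δ ^ 2)
    (ht : 0 ≤ t) (hρ : 6 * ((d : ℝ) - 1) * |β| * (exp a * exp t * Real.sqrt (c * v)) + exp (a / 2) * Real.sqrt c * Λt < 1)
    (hW : MemBallZdS a Λt t W) {η Λη : ℝ} (hV' : MemBallZdS η Λη t V')
    {μ μ' : Measure (LGConfig d (Matrix.specialUnitaryGroup (Fin N) ℂ))}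
    (hμ : μ ∈ perturbedGibbsMeasuresS (d := d) (fundamentalRep (Fin N)) (N * β) W)
    (hμ' : μ' ∈ perturbedGibbsMeasuresS (d := d) (fundamentalRep (Fin N)) (N * β) (W + V'))
    {f : LGConfig d (Matrix.specialUnitaryGroup (Fin N) ℂ) → ℝ} (hfm : Measurable f) {Δf : Finset (ZdEdge d)}
    (hfdep : DependsOn f (↑Δf : Set (ZdEdge d))) {δf : ZdEdge d → ℝ} (hδf : IsLipBound suFrobDist f δf)
    {g : LGConfig d (Matrix.specialUnitaryGroup (Fin N) ℂ) → ℝ} (hgm : Measurable g) {Δg : Finset (ZdEdge d)}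
    (hgdep : DependsOn g (↑Δg : Set (ZdEdge d))) {δg : ZdEdge d → ℝ} (hδg : IsLipBound suFrobDist g δg) :
    |cov[f, g; μ'] - cov[f, g; μ]| ≤
      4 * N * (min η 4 / (1 - (6 * ((d : ℝ) - 1) * |β| * (exp a * exp t * Real.sqrt (c * v)) + exp (a / 2) * Real.sqrt c * Λt))) *
        (∑ y ∈ Δf, δf y) * ∑ y ∈ Δg, δg y := by
  classical
  haveI : SecondCountableTopology (Matrix (Fin N) (Fin N) ℂ) :=
    inferInstanceAs (SecondCountableTopology (Fin N → Fin N → ℂ))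
  haveI : SecondCountableTopology (Matrix.specialUnitaryGroup (Fin N) ℂ) :=
    Topology.IsEmbedding.subtypeVal.secondCountableTopology
  have hμP : IsGibbsMeasure (perturbedYMS (d := d) (fundamentalRep (Fin N)) (N * β) W) μ := hμ
  have hμ'P : IsGibbsMeasure (perturbedYMS (d := d) (fundamentalRep (Fin N)) (N * β) (W + V')) μ' := hμ'
  haveI := hμP.isProbabilityMeasure
  haveI := hμ'P.isProbabilityMeasure
  obtain ⟨BW, hBW⟩ := hW.summable
  obtain ⟨osc, lip, ℓ, hosc, hlip, hoscs, hosca, hlips, hℓ, hℓs, hℓt⟩ := hW.loads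
  obtain ⟨BV, hBV⟩ := hV'.summable
  obtain ⟨oscV, lipV', ℓV, hoscV, -, hoscVs, hoscVa, -, -, -, -⟩ := hV'.loads
  obtain ⟨ρ, hρdef⟩ : ∃ ρ : ℝ, ρ = 6 * ((d : ℝ) - 1) * |β| * (exp a * exp t * Real.sqrt (c * v)) + exp (a / 2) * Real.sqrt c * Λt :=
    ⟨_, rfl⟩
  rw [← hρdef] at hρ ⊢
  -- the state-stability bound, for any bounded local Frobenius-Lipschitz observable
  have hstab : ∀ {h : LGConfig d (Matrix.specialUnitaryGroup (Fin N) ℂ) → ℝ}, Measurable h → ∀ {Δ : Finset (ZdEdge d)},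
      DependsOn h (↑Δ : Set (ZdEdge d)) → ∀ {M : ℝ}, (∀ σ, |h σ| ≤ M) → ∀ {δ : ZdEdge d → ℝ}, IsLipBound suFrobDist h δ →
      |(∫ σ, h σ ∂μ) - ∫ σ, h σ ∂μ'| ≤ Real.sqrt N / 2 * min η 4 / (1 - ρ) * ∑ y ∈ Δ, δ y := by
    intro h hhm Δ hhdep M hM δ hδ
    have key := abs_integral_sub_integral_le_of_perturbation_S hd hN hc hv hb hP hVB hBW hW.continuous hW.dependsOn hosc hoscs
      hosca hlip hlips hℓ ht hℓs hℓt (hρdef ▸ hρ) hBV hV'.continuous hV'.dependsOn hoscV hoscVs (bV := fun _ => η) hoscVa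
      (fun _ => le_rfl) hμ hμ' hhm hhdep hM hδ
    rw [← hρdef] at key
    exact key
  -- bounds of integrals of bounded functions
  have habsint : ∀ (ν : Measure (LGConfig d (Matrix.specialUnitaryGroup (Fin N) ℂ))) [IsProbabilityMeasure ν]
      {h : LGConfig d (Matrix.specialUnitaryGroup (Fin N) ℂ) → ℝ} {M : ℝ}, (∀ σ, |h σ| ≤ M) → |∫ σ, h σ ∂ν| ≤ M := by
    intro ν _ h M hM
    have h1 := norm_integral_le_of_norm_le_const (μ := ν) (f := h) (C := M) (Filter.Eventually.of_forall fun σ => by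
      rw [Real.norm_eq_abs]; exact hM σ)
    rwa [Real.norm_eq_abs, probReal_univ, mul_one] at h1
  -- centring at the unit configuration
  obtain ⟨f₁, hf₁⟩ : ∃ f₁ : LGConfig d (Matrix.specialUnitaryGroup (Fin N) ℂ) → ℝ, f₁ = fun σ => f σ - f 1 := ⟨_, rfl⟩
  obtain ⟨g₁, hg₁⟩ : ∃ g₁ : LGConfig d (Matrix.specialUnitaryGroup (Fin N) ℂ) → ℝ, g₁ = fun σ => g σ - g 1 := ⟨_, rfl⟩
  have hf₁m : Measurable f₁ := hf₁ ▸ hfm.sub measurable_const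
  have hg₁m : Measurable g₁ := hg₁ ▸ hgm.sub measurable_const
  have hf₁dep : DependsOn f₁ (↑Δf : Set (ZdEdge d)) := fun σ τ hστ => by simp only [hf₁, hfdep hστ]
  have hg₁dep : DependsOn g₁ (↑Δg : Set (ZdEdge d)) := fun σ τ hστ => by simp only [hg₁, hgdep hστ]
  have hf₁lip : IsLipBound suFrobDist f₁ δf :=
    ⟨hδf.nonneg, fun y σ τ hστ => by simpa only [hf₁, sub_sub_sub_cancel_right] using hδf.le y σ τ hστ⟩
  have hg₁lip : IsLipBound suFrobDist g₁ δg :=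
    ⟨hδg.nonneg, fun y σ τ hστ => by simpa only [hg₁, sub_sub_sub_cancel_right] using hδg.le y σ τ hστ⟩
  obtain ⟨Sf, hSf⟩ : ∃ S : ℝ, S = ∑ y ∈ Δf, δf y := ⟨_, rfl⟩
  obtain ⟨Sg, hSg⟩ : ∃ S : ℝ, S = ∑ y ∈ Δg, δg y := ⟨_, rfl⟩
  have hSf0 : 0 ≤ Sf := hSf ▸ sum_nonneg fun y _ => hδf.nonneg y
  have hSg0 : 0 ≤ Sg := hSg ▸ sum_nonneg fun y _ => hδg.nonneg y
  have hN0 : (0 : ℝ) ≤ 2 * Real.sqrt N := by positivity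
  -- sup bounds by interpolation along the links of the support
  have hMf : ∀ σ, |f₁ σ| ≤ 2 * Real.sqrt N * Sf := fun σ => by
    rw [hf₁, hSf]
    calc |f σ - f 1| ≤ ∑ y ∈ Δf, δf y * suFrobDist (σ y) ((1 : LGConfig d (Matrix.specialUnitaryGroup (Fin N) ℂ)) y) :=
          abs_sub_le_sum_of_dependsOn hfdep hδf σ 1
      _ ≤ ∑ y ∈ Δf, δf y * (2 * Real.sqrt N) :=
          sum_le_sum fun y _ => mul_le_mul_of_nonneg_left (suFrobDist_le _ _) (hδf.nonneg y)
      _ = 2 * Real.sqrt N * ∑ y ∈ Δf, δf y := by rw [← sum_mul]; ring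
  have hMg : ∀ σ, |g₁ σ| ≤ 2 * Real.sqrt N * Sg := fun σ => by
    rw [hg₁, hSg]
    calc |g σ - g 1| ≤ ∑ y ∈ Δg, δg y * suFrobDist (σ y) ((1 : LGConfig d (Matrix.specialUnitaryGroup (Fin N) ℂ)) y) :=
          abs_sub_le_sum_of_dependsOn hgdep hδg σ 1
      _ ≤ ∑ y ∈ Δg, δg y * (2 * Real.sqrt N) :=
          sum_le_sum fun y _ => mul_le_mul_of_nonneg_left (suFrobDist_le _ _) (hδg.nonneg y)
      _ = 2 * Real.sqrt N * ∑ y ∈ Δg, δg y := by rw [← sum_mul]; ring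
  have hMf0 : 0 ≤ 2 * Real.sqrt N * Sf := mul_nonneg hN0 hSf0
  have hMg0 : 0 ≤ 2 * Real.sqrt N * Sg := mul_nonneg hN0 hSg0
  -- the product `f₁ g₁`: measurable, local on `Δf ∪ Δg`, bounded, coordinatewise Lipschitz
  have hpm : Measurable fun σ => f₁ σ * g₁ σ := hf₁m.mul hg₁m
  have hpdep : DependsOn (fun σ => f₁ σ * g₁ σ) (↑(Δf ∪ Δg) : Set (ZdEdge d)) := fun σ τ hστ => by
    show f₁ σ * g₁ σ = f₁ τ * g₁ τ
    rw [hf₁dep (fun y hy => hστ y (by simp [Finset.mem_coe.1 hy])), hg₁dep (fun y hy => hστ y (by simp [Finset.mem_coe.1 hy]))]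
  have hMp : ∀ σ, |f₁ σ * g₁ σ| ≤ 2 * Real.sqrt N * Sf * (2 * Real.sqrt N * Sg) := fun σ => by
    rw [abs_mul]; exact mul_le_mul (hMf σ) (hMg σ) (abs_nonneg _) hMf0
  have hf₁lip' : IsLipBound suFrobDist f₁ (fun y => if y ∈ Δf then δf y else 0) := hf₁lip.restrict hf₁dep
  have hg₁lip' : IsLipBound suFrobDist g₁ (fun y => if y ∈ Δg then δg y else 0) := hg₁lip.restrict hg₁dep
  have hplip : IsLipBound suFrobDist (fun σ => f₁ σ * g₁ σ)
      (fun y => 2 * Real.sqrt N * Sf * (if y ∈ Δg then δg y else 0) + 2 * Real.sqrt N * Sg * (if y ∈ Δf then δf y else 0)) := by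
    refine ⟨fun y => add_nonneg (mul_nonneg hMf0 (hg₁lip'.nonneg y)) (mul_nonneg hMg0 (hf₁lip'.nonneg y)), fun y σ τ hστ => ?_⟩
    have h1 : |f₁ σ| * |g₁ σ - g₁ τ| ≤ 2 * Real.sqrt N * Sf * ((if y ∈ Δg then δg y else 0) * suFrobDist (σ y) (τ y)) :=
      (mul_le_mul_of_nonneg_left (hg₁lip'.le y σ τ hστ) (abs_nonneg _)).trans
        (mul_le_mul_of_nonneg_right (hMf σ) (mul_nonneg (hg₁lip'.nonneg y) (suFrobDist_nonneg _ _)))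
    have h2 : |f₁ σ - f₁ τ| * |g₁ τ| ≤ (if y ∈ Δf then δf y else 0) * suFrobDist (σ y) (τ y) * (2 * Real.sqrt N * Sg) :=
      (mul_le_mul_of_nonneg_left (hMg τ) (abs_nonneg _)).trans
        (mul_le_mul_of_nonneg_right (hf₁lip'.le y σ τ hστ) hMg0)
    calc |f₁ σ * g₁ σ - f₁ τ * g₁ τ| = |f₁ σ * (g₁ σ - g₁ τ) + (f₁ σ - f₁ τ) * g₁ τ| := by ring_nf
      _ ≤ |f₁ σ * (g₁ σ - g₁ τ)| + |(f₁ σ - f₁ τ) * g₁ τ| := abs_add_le _ _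
      _ = |f₁ σ| * |g₁ σ - g₁ τ| + |f₁ σ - f₁ τ| * |g₁ τ| := by rw [abs_mul, abs_mul]
      _ ≤ _ := add_le_add h1 h2
      _ = _ := by ring
  -- three applications of state stability
  have e1 := hstab hpm hpdep hMp hplip
  have e2 := hstab hf₁m hf₁dep hMf hf₁lip
  have e3 := hstab hg₁m hg₁dep hMg hg₁lip
  have hsum1 : ∑ y ∈ Δf ∪ Δg, (2 * Real.sqrt N * Sf * (if y ∈ Δg then δg y else 0) +
      2 * Real.sqrt N * Sg * (if y ∈ Δf then δf y else 0)) = 4 * Real.sqrt N * Sf * Sg := by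
    rw [sum_add_distrib, ← mul_sum, ← mul_sum, Finset.sum_ite_mem, Finset.sum_ite_mem, Finset.union_inter_cancel_right,
      Finset.union_inter_cancel_left, ← hSf, ← hSg]
    ring
  rw [hsum1] at e1
  rw [← hSf] at e2
  rw [← hSg] at e3
  -- the covariance in terms of the centred observables
  have hcov : ∀ (ν : Measure (LGConfig d (Matrix.specialUnitaryGroup (Fin N) ℂ))), IsProbabilityMeasure ν →
      cov[f, g; ν] = (∫ σ, f₁ σ * g₁ σ ∂ν) - (∫ σ, f₁ σ ∂ν) * ∫ σ, g₁ σ ∂ν := by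
    intro ν hν
    have hf2 : MemLp f₁ 2 ν := MemLp.of_bound hf₁m.aestronglyMeasurable _
      (Filter.Eventually.of_forall fun σ => by rw [Real.norm_eq_abs]; exact hMf σ)
    have hg2 : MemLp g₁ 2 ν := MemLp.of_bound hg₁m.aestronglyMeasurable _
      (Filter.Eventually.of_forall fun σ => by rw [Real.norm_eq_abs]; exact hMg σ)
    have hfi : Integrable f ν := by
      have hf' : f = fun σ => f₁ σ + f 1 := funext fun σ => by simp [hf₁]
      rw [hf']; exact (hf2.integrable one_le_two).add (integrable_const _)
    have hgi : Integrable g ν := by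
      have hg' : g = fun σ => g₁ σ + g 1 := funext fun σ => by simp [hg₁]
      rw [hg']; exact (hg2.integrable one_le_two).add (integrable_const _)
    rw [← covariance_sub_const_left hfi (f 1), ← covariance_sub_const_right hgi (g 1), ← hf₁, ← hg₁, covariance_eq_sub hf2 hg2]
    rfl
  rw [hcov μ' inferInstance, hcov μ inferInstance]
  have hA : |∫ σ, f₁ σ ∂μ'| ≤ 2 * Real.sqrt N * Sf := habsint μ' hMf
  have hB : |∫ σ, g₁ σ ∂μ| ≤ 2 * Real.sqrt N * Sg := habsint μ hMg
  have hCs0 : 0 ≤ Real.sqrt N / 2 * min η 4 / (1 - ρ) := by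
    have h1 : 0 ≤ Real.sqrt N / 2 * min η 4 / (1 - ρ) * Sf := (abs_nonneg _).trans e2
    by_cases hS : Sf = 0
    · -- then also `e3`'s constant is what we need; use `Sg` instead, or conclude trivially
      by_cases hS' : Sg = 0
      · -- both supports carry zero Lipschitz mass: the constant's sign is irrelevant below, but we still record nonnegativity
        have h1ρ : 0 < 1 - ρ := sub_pos.2 hρ
        have hη0 : 0 ≤ min η 4 := by
          have hd0 : 0 < d := hd
          have h0 : (0 : ℝ) ≤ η := le_trans (tsum_nonneg fun X => by
            split_ifs
            · exact (hoscV X).nonneg _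
            · exact le_rfl) (hoscVa (0, ⟨0, hd0⟩))
          exact le_min h0 (by norm_num)
        positivity
      · exact le_of_mul_le_mul_right (by simpa using (abs_nonneg _).trans e3) (lt_of_le_of_ne hSg0 (Ne.symm hS'))
    · exact le_of_mul_le_mul_right (by simpa using h1) (lt_of_le_of_ne hSf0 (Ne.symm hS))
  have hNN : Real.sqrt N * Real.sqrt N = N := Real.mul_self_sqrt (Nat.cast_nonneg N)
  calc |(∫ σ, f₁ σ * g₁ σ ∂μ') - (∫ σ, f₁ σ ∂μ') * (∫ σ, g₁ σ ∂μ') -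
        ((∫ σ, f₁ σ * g₁ σ ∂μ) - (∫ σ, f₁ σ ∂μ) * ∫ σ, g₁ σ ∂μ)|
      = |((∫ σ, f₁ σ * g₁ σ ∂μ') - ∫ σ, f₁ σ * g₁ σ ∂μ) -
          ((∫ σ, f₁ σ ∂μ') * ((∫ σ, g₁ σ ∂μ') - ∫ σ, g₁ σ ∂μ) + ((∫ σ, f₁ σ ∂μ') - ∫ σ, f₁ σ ∂μ) * ∫ σ, g₁ σ ∂μ)| := by
        ring_nf
    _ ≤ |(∫ σ, f₁ σ * g₁ σ ∂μ') - ∫ σ, f₁ σ * g₁ σ ∂μ| +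
          |(∫ σ, f₁ σ ∂μ') * ((∫ σ, g₁ σ ∂μ') - ∫ σ, g₁ σ ∂μ) + ((∫ σ, f₁ σ ∂μ') - ∫ σ, f₁ σ ∂μ) * ∫ σ, g₁ σ ∂μ| :=
        abs_sub _ _
    _ ≤ |(∫ σ, f₁ σ * g₁ σ ∂μ') - ∫ σ, f₁ σ * g₁ σ ∂μ| +
          (|∫ σ, f₁ σ ∂μ'| * |(∫ σ, g₁ σ ∂μ') - ∫ σ, g₁ σ ∂μ| + |(∫ σ, f₁ σ ∂μ') - ∫ σ, f₁ σ ∂μ| * |∫ σ, g₁ σ ∂μ|) := by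
        gcongr
        exact (abs_add_le _ _).trans (by rw [abs_mul, abs_mul])
    _ ≤ Real.sqrt N / 2 * min η 4 / (1 - ρ) * (4 * Real.sqrt N * Sf * Sg) +
          (2 * Real.sqrt N * Sf * (Real.sqrt N / 2 * min η 4 / (1 - ρ) * Sg) +
            Real.sqrt N / 2 * min η 4 / (1 - ρ) * Sf * (2 * Real.sqrt N * Sg)) := by
        rw [abs_sub_comm] at e1 e2 e3
        exact add_le_add e1 (add_le_add (mul_le_mul hA e3 (abs_nonneg _) hMf0)
          (mul_le_mul e2 hB (abs_nonneg _) (mul_nonneg hCs0 hSf0)))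
    _ = 4 * (Real.sqrt N * Real.sqrt N) * (min η 4 / (1 - ρ)) * Sf * Sg := by ring
    _ = 4 * N * (min η 4 / (1 - ρ)) * Sf * Sg := by rw [hNN]
    _ = _ := by rw [hSf, hSg]

end SUN

/-! ### `SU(2)`, `ℤ⁴`, uniformly on the weighted ball, hypothesis-free -/

/-- **`SU(2)`, `ℤ⁴` — CONNECTED CORRELATIONS ARE LIPSCHITZ IN THE ACTION, uniformly on `MemBallZdS a Λ t`.**  `0 ≤ t`,
`6|β_W| e^{a} e^{t} + e^{a/2} √(2/3) Λ < 1` ⇒ for every member `W` (bare coupling `β_W/2`), every modification `V' ∈ MemBallZdS η Λ_η t` (ANY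
strength, ANY range; oscillation load `≤ η`), every DLR `μ` of `W`, EVERY DLR `μ'` of `W + V'` and every two Lipschitz cylinders `F`, `G`:
`|cov_{μ'}(F, G) − cov_μ(F, G)| ≤ 8 · min(η,4)/(1 − ρ) · (#Λ_F K_F)(#Λ_G K_G)`, `ρ = 6|β_W| e^{a} e^{t} + e^{a/2} √(2/3) Λ`. -/
theorem su2_abs_cov_sub_cov_le_dim4 {βW a Λ t η Λη : ℝ} (ht : 0 ≤ t)
    (hρ : 6 * |βW| * (exp a * exp t) + exp (a / 2) * Real.sqrt (2 / 3) * Λ < 1)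
    {W V' : Potential (ZdEdge 4) (Matrix.specialUnitaryGroup (Fin 2) ℂ)} (hW : MemBallZdS a Λ t W) (hV' : MemBallZdS η Λη t V')
    {μ μ' : Measure (LGConfig 4 (Matrix.specialUnitaryGroup (Fin 2) ℂ))}
    (hμ : μ ∈ perturbedGibbsMeasuresS (d := 4) (fundamentalRep (Fin 2)) (2 * (βW / 4)) W)
    (hμ' : μ' ∈ perturbedGibbsMeasuresS (d := 4) (fundamentalRep (Fin 2)) (2 * (βW / 4)) (W + V'))
    {F : LGConfig 4 (Matrix.specialUnitaryGroup (Fin 2) ℂ) → ℝ} {ΛF : Finset (ZdEdge 4)} {KF : ℝ≥0}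
    (hF : IsLipschitzCylinder (fundamentalRep (Fin 2)) F ΛF KF)
    {G : LGConfig 4 (Matrix.specialUnitaryGroup (Fin 2) ℂ) → ℝ} {ΛG : Finset (ZdEdge 4)} {KG : ℝ≥0}
    (hG : IsLipschitzCylinder (fundamentalRep (Fin 2)) G ΛG KG) :
    |cov[F, G; μ'] - cov[F, G; μ]| ≤
      8 * (min η 4 / (1 - (6 * |βW| * (exp a * exp t) + exp (a / 2) * Real.sqrt (2 / 3) * Λ))) * (ΛF.card * KF) * (ΛG.card * KG) := by
  classical
  have hc : (0 : ℝ) ≤ 2 / 3 := by norm_num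
  have hP : ∀ B : Matrix (Fin 2) (Fin 2) ℂ, matrixOpNorm B ≤ |βW / 4| * (2 * (((4 : ℕ) : ℝ) - 1)) →
      ∀ (ψ : Matrix.specialUnitaryGroup (Fin 2) ℂ → ℝ) (M : ℝ), 0 ≤ M →
        (∀ x y, |ψ x - ψ y| ≤ M * suFrobDist x y) →
        Var[ψ; (haarProbability (Matrix.specialUnitaryGroup (Fin 2) ℂ)).tilted
          fun g => ((2 : ℕ) : ℝ) * ((g : Matrix (Fin 2) (Fin 2) ℂ) * B).trace.re] ≤ 2 / 3 * M ^ 2 :=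
    fun B hB ψ M hM hψ => oneLinkPoincareSUN_two_sharp _ B hB ψ M hM hψ
  have hVB := linVariance_of_poincare (N := 2) hP
  have hv : (0 : ℝ) ≤ 2 / 3 * ((2 : ℕ) : ℝ) ^ 2 := by norm_num
  have hsq : Real.sqrt (2 / 3 * (2 / 3 * ((2 : ℕ) : ℝ) ^ 2)) = 4 / 3 := by
    rw [show (2 / 3 * (2 / 3 * ((2 : ℕ) : ℝ) ^ 2) : ℝ) = (4 / 3) ^ 2 by norm_num, Real.sqrt_sq (by norm_num)]
  have hρeq : 6 * (((4 : ℕ) : ℝ) - 1) * |βW / 4| * (exp a * exp t * Real.sqrt (2 / 3 * (2 / 3 * ((2 : ℕ) : ℝ) ^ 2))) +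
      exp (a / 2) * Real.sqrt (2 / 3) * Λ = 6 * |βW| * (exp a * exp t) + exp (a / 2) * Real.sqrt (2 / 3) * Λ := by
    rw [hsq, abs_div, abs_of_pos (by norm_num : (0 : ℝ) < 4)]
    norm_num; ring
  have hρ' : 6 * (((4 : ℕ) : ℝ) - 1) * |βW / 4| * (exp a * exp t * Real.sqrt (2 / 3 * (2 / 3 * ((2 : ℕ) : ℝ) ^ 2))) +
      exp (a / 2) * Real.sqrt (2 / 3) * Λ < 1 := by rw [hρeq]; exact hρ
  have hμ₁ : μ ∈ perturbedGibbsMeasuresS (d := 4) (fundamentalRep (Fin 2)) ((2 : ℕ) * (βW / 4)) W := by simpa using hμ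
  have hμ₁' : μ' ∈ perturbedGibbsMeasuresS (d := 4) (fundamentalRep (Fin 2)) ((2 : ℕ) * (βW / 4)) (W + V') := by simpa using hμ'
  have hA : ∀ a b : Matrix.specialUnitaryGroup (Fin 2) ℂ, dist (suEntries a) (suEntries b) ≤ 1 * suFrobDist a b :=
    fun a b => by rw [one_mul]; exact dist_suEntries_le_suFrobDist a b
  have key := abs_cov_sub_cov_le_of_perturbation_S (N := 2) (d := 4) (by norm_num) (by norm_num) hc hv le_rfl hP hVB ht hρ' hW hV'
    hμ₁ hμ₁' hF.measurable hF.dependsOn (hF.isLipBound zero_le_one hA) hG.measurable hG.dependsOn (hG.isLipBound zero_le_one hA)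
  rw [hρeq] at key
  refine key.trans (le_of_eq ?_)
  have hsumF : ∑ y ∈ ΛF, (if y ∈ ΛF then (1 : ℝ) * (KF : ℝ) else 0) = ΛF.card * KF := by
    rw [Finset.sum_congr rfl fun y hy => by rw [if_pos hy, one_mul], Finset.sum_const, nsmul_eq_mul]
  have hsumG : ∑ y ∈ ΛG, (if y ∈ ΛG then (1 : ℝ) * (KG : ℝ) else 0) = ΛG.card * KG := by
    rw [Finset.sum_congr rfl fun y hy => by rw [if_pos hy, one_mul], Finset.sum_const, nsmul_eq_mul]
  rw [hsumF, hsumG]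
  norm_num

end Summit.Ventures.YMGap.RobustBall

end
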